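import Summits.KontsevichZagierPeriods.KontsevichZagierPeriods.Theses.FermatIsogeny
import Summits.KontsevichZagierPeriods.KontsevichZagierPeriods.Theorems.FermatIsogenyBetaLinearSectorHalfIntegers
import Summits.KontsevichZagierPeriods.KontsevichZagierPeriods.Theorems.TorsionLogsGKZLevelThreePairBetaArctan
import Summits.KontsevichZagierPeriods.KontsevichZagierPeriods.Theorems.BetaCancellation.Negative.EulerReflectionStub
import Literature.NumberTheory.Transcendental.KZProduct
import Summits.KontsevichZagierPeriods.KontsevichZagierPeriods.Theorems.FermatIsogenyBetaLinearSectorQuartersStubQuarticBeta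
import Summits.KontsevichZagierPeriods.KontsevichZagierPeriods.Theorems.FermatIsogenyBetaLinearSectorQuartersStubQuarticHalf
import Summits.KontsevichZagierPeriods.KontsevichZagierPeriods.Theorems.FermatIsogenyBetaLinearSectorQuartersStubQuarticLorentz
import Summits.KontsevichZagierPeriods.KontsevichZagierPeriods.Theorems.FermatIsogenyBetaLinearSectorQuartersStubLorentzDisc
import Summits.KontsevichZagierPeriods.KontsevichZagierPeriods.Theorems.FermatIsogenyBetaLinearSectorQuartersStubBetaFold
import Summits.KontsevichZagierPeriods.KontsevichZagierPeriods.Theorems.FermatIsogenyBetaLinearSectorQuartersStubBetaDuplication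

/-!
# `BetaLinearSector` at level `4` — BRIDGES: Euler's reflection at `1/4` and Legendre's duplication, inside the calculus

Support file of crux `BetaLinearSector` (stmt-KontsevichZagierPeriods-3897, route FermatIsogeny) for the UNCONDITIONAL RUNG on
parameters in `¼ℤ` (`Theorems/FermatIsogenyBetaLinearSectorQuarters.lean`).  At level `4` two families of Beta cells share a value
class without being related by the landed translation/swap chains, and this file realises both coincidences by Kontsevich–Zagier moves:

* **Euler's reflection at `a = 1/4`** (`eulerReflectionRational_one_quarter`, the instance `a = 1/4` of crux `EulerReflectionRational`
  of route CompiledSubstitutions, stmt-3383, VERBATIM shape; registered anchor of this file): `[(0,1), sin(π/4)·x^{-3/4}(1-x)^{-1/4}] ∼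
  [closed unit disc, 1]`, i.e. `sin(π/4)·B(1/4,3/4) = π` by moves.  Chain (four registered stubs of the line, each ONE or TWO moves):
  `x = w⁴/(w⁴+(1−w)⁴)` makes the cell rational, `[(0,1), 4(1−w)²/Q]`, `Q = w⁴+(1−w)⁴` (`stub_quarticRational_equivalent_beta`); fold at
  `1/2` (`stub_quarticRational_equivalent_half`); ONE substitution `u = √2·w(1−w)/(1−2w)` onto the half-line Lorentzian
  `[(0,∞), 2√2/(1+u²)]`, thanks to the identity `(1−2w)² + 2w²(1−w)² = Q(w)` (`stub_quarticHalf_equivalent_lorentz`); Cayley map +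
  `PiNormalisation` to the disc (`stub_lorentzHalfLine_equivalent_disc`).  Consequence in the rung's language: a cell pinned as
  `[c·β(1/4,3/4)]` is a chain of moves away from `(c√2)·[β(1/2,1/2)]` (`pinned_quarter_threeQuarter_equivalent`, through
  `stubEulerReflection_half`).
* **Legendre's duplication in linear form** (`pinned_duplication`, every rational `a > 0`): `[β(a,a)] ∼ [2^{1−2a}·β(a,1/2)]` — fold the
  symmetric cell at `1/2` (`stub_betaSymm_fold`) and substitute `u = 4x(1−x)` (`stub_betaFold_duplication`).

Also: existence of the intermediate representations (`exists_quarticRationalRep`, `exists_quarticHalfRep`, `exists_lorentzHalfLineRep`).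
References: M. Kontsevich, D. Zagier, *Periods* (2001), §1.2; G. E. Andrews, R. Askey, R. Roy, *Special Functions* (1999), Thm 1.2.1,
Thm 1.5.1 (Legendre duplication).
-/

noncomputable section

namespace Summit.KontsevichZagierPeriods.FermatIsogeny.BetaLinearSector.Quarters

open MeasureTheory Set Literature.NumberTheory.Transcendental Literature.NumberTheory.Transcendental.KZ
open MvPolynomial (X C)
open Literature.ModelTheory.ExponentialFields (IsSemialgebraic)
open Summit.KontsevichZagierPeriods.FermatIsogeny.BetaLinearSector.HalfIntegers
open Summit.KontsevichZagierPeriods.KontsevichZagierPeriods.Theorems.GKZLevelThree (exists_rep_Ioo₁ isSemialgebraicFunOn_ratFun₁)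
open Summit.KontsevichZagierPeriods.KontsevichZagierPeriods.BetaCancellationNegative (stubEulerReflection_half isAlgebraic_sin_pi_mul_rat)

set_option quotPrecheck false in
/-- `r` is PINNED as `[(0,1), c · t^{a-1}(1-t)^{b-1}]` (the two hypotheses on each representation in the crux, with a constant). -/
local notation "Pinned⟦" c ", " a ", " b ", " r "⟧" =>
  (IntegralRep.domain r = {x : Fin 1 → ℝ | x 0 ∈ Set.Ioo (0:ℝ) 1} ∧
    Set.EqOn (IntegralRep.integrand r) (fun x : Fin 1 → ℝ => (c : ℝ) * (x 0) ^ (((a : ℚ) : ℝ) - 1) * (1 - x 0) ^ (((b : ℚ) : ℝ) - 1))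
      (IntegralRep.domain r))

/-! ## The intermediate representations exist -/

/-- `(1/2 : ℝ)` is algebraic. [folklore] -/
theorem isAlgebraic_one_half : IsAlgebraic ℚ ((1 : ℝ) / 2) := by
  simpa using isAlgebraic_algebraMap (R := ℚ) (A := ℝ) (1 / 2 : ℚ)

/-- The rational cell `[(0,1), 4(1−w)²/(w⁴+(1−w)⁴)]` exists. [cite: KontsevichZagier2001, §1.1] -/
theorem exists_quarticRationalRep : ∃ W : IntegralRep 1, W.domain = {x | x 0 ∈ Set.Ioo (0:ℝ) 1} ∧
    W.integrand = fun x => 4 * (1 - x 0) ^ 2 / ((x 0) ^ 4 + (1 - x 0) ^ 4) := by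
  obtain ⟨W, hWd, hWi⟩ := exists_rep_Ioo₁ isAlgebraic_zero isAlgebraic_one
    (fun w => 4 * (1 - w) ^ 2 / (w ^ 4 + (1 - w) ^ 4))
    ((by fun_prop : Continuous fun w : ℝ => 4 * (1 - w) ^ 2).continuousOn.div (by fun_prop)
      fun w _ => (quartic_den_pos w).ne') (by
    refine isSemialgebraicFunOn_ratFun₁ ((KZ.isSemialgebraic_setOf_const_lt_apply isAlgebraic_zero 0).inter
      (KZ.isSemialgebraic_setOf_apply_lt_const isAlgebraic_one 0))
      (C 4 * (1 - X 0) ^ 2) (X 0 ^ 4 + (1 - X 0) ^ 4) (fun w => 4 * (1 - w) ^ 2 / (w ^ 4 + (1 - w) ^ 4))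
      (fun x _ => ?_) (fun x _ => ?_)
    · simp only [map_add, map_sub, map_pow, MvPolynomial.aeval_X, map_one]
      exact (quartic_den_pos (x 0)).ne'
    · simp)
  refine ⟨W, ?_, hWi⟩
  rw [hWd]
  ext x
  simp [mem_Ioo]

/-- The folded cell `[(0,1/2), 4((1−w)²+w²)/(w⁴+(1−w)⁴)]` exists. [cite: KontsevichZagier2001, §1.1] -/
theorem exists_quarticHalfRep : ∃ H : IntegralRep 1, H.domain = {x : Fin 1 → ℝ | 0 < x 0 ∧ x 0 < 1 / 2} ∧
    H.integrand = fun x => 4 * ((1 - x 0) ^ 2 + (x 0) ^ 2) / ((x 0) ^ 4 + (1 - x 0) ^ 4) := by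
  refine exists_rep_Ioo₁ isAlgebraic_zero isAlgebraic_one_half
    (fun w => 4 * ((1 - w) ^ 2 + w ^ 2) / (w ^ 4 + (1 - w) ^ 4))
    ((by fun_prop : Continuous fun w : ℝ => 4 * ((1 - w) ^ 2 + w ^ 2)).continuousOn.div (by fun_prop)
      fun w _ => (quartic_den_pos w).ne') ?_
  refine isSemialgebraicFunOn_ratFun₁ ((KZ.isSemialgebraic_setOf_const_lt_apply isAlgebraic_zero 0).inter
    (KZ.isSemialgebraic_setOf_apply_lt_const isAlgebraic_one_half 0))
    (C 4 * ((1 - X 0) ^ 2 + X 0 ^ 2)) (X 0 ^ 4 + (1 - X 0) ^ 4) (fun w => 4 * ((1 - w) ^ 2 + w ^ 2) / (w ^ 4 + (1 - w) ^ 4))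
    (fun x _ => ?_) (fun x _ => ?_)
  · simp only [map_add, map_sub, map_pow, MvPolynomial.aeval_X, map_one]
    exact (quartic_den_pos (x 0)).ne'
  · simp

/-- The half-line Lorentzian `[(0,∞), 2/(1+u²)]` exists (integrable: `∫ du/(1+u²) < ∞`). [cite: KontsevichZagier2001, §1.1] -/
theorem exists_lorentzHalfLineRep : ∃ L : IntegralRep 1, L.domain = {x : Fin 1 → ℝ | 0 < x 0} ∧
    L.integrand = fun x => 2 / (1 + (x 0) ^ 2) := by
  have hdom : IsSemialgebraic ℚ {x : Fin 1 → ℝ | 0 < x 0} := KZ.isSemialgebraic_setOf_const_lt_apply isAlgebraic_zero 0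
  have hsa : IsSemialgebraicFunOn ℚ {x : Fin 1 → ℝ | 0 < x 0} (fun x => 2 / (1 + (x 0) ^ 2)) := by
    refine isSemialgebraicFunOn_ratFun₁ hdom (C 2) (1 + X 0 ^ 2) (fun u => 2 / (1 + u ^ 2)) (fun x _ => ?_) (fun x _ => ?_)
    · simp only [map_add, map_pow, MvPolynomial.aeval_X, map_one]
      positivity
    · simp
  have hint : IntegrableOn (fun x : Fin 1 → ℝ => 2 / (1 + (x 0) ^ 2)) {x : Fin 1 → ℝ | 0 < x 0} := by
    have h2 : Integrable (fun u : ℝ => 2 / (1 + u ^ 2)) := by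
      have := integrable_inv_one_add_sq.const_mul (2:ℝ)
      refine this.congr (ae_of_all _ fun u => ?_)
      simp [div_eq_mul_inv]
    have h : IntegrableOn (fun x : Fin 1 → ℝ => (fun u : ℝ => 2 / (1 + u ^ 2)) (x 0)) {x : Fin 1 → ℝ | x 0 ∈ Ioi (0:ℝ)} :=
      (integrableOn_setOf_apply_mem_iff (g := fun u : ℝ => 2 / (1 + u ^ 2)) (S := Ioi (0:ℝ))).2 h2.integrableOn
    simpa [mem_Ioi] using h
  exact ⟨⟨_, _, hdom, hsa, hint⟩, rfl, rfl⟩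

/-! ## Euler's reflection at `1/4` -/

/-- **`B(1/4,3/4) = √2·π` inside the rules**: every Beta cell `[(0,1), x^{-3/4}(1-x)^{-1/4}]` is KZ-equivalent to `√2·[π]`
(`KZ.piRep` = the closed unit disc), by the four stubs of the chain and one scaling. [cite: KontsevichZagier2001, §1.2]
[cite: AndrewsAskeyRoy1999, Thm 1.2.1] -/
theorem betaQuarter_equivalent_piRep_sqrt2 (h2 : IsAlgebraic ℚ (Real.sqrt 2)) (β : IntegralRep 1)
    (hβd : β.domain = {x | x 0 ∈ Set.Ioo (0:ℝ) 1})
    (hβi : EqOn β.integrand (fun x => (x 0) ^ (-(3:ℝ) / 4) * (1 - x 0) ^ (-(1:ℝ) / 4)) β.domain) :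
    Equivalent β (piRep.constMul (Real.sqrt 2) h2) := by
  obtain ⟨W, hWd, hWi⟩ := exists_quarticRationalRep
  obtain ⟨H, hHd, hHi⟩ := exists_quarticHalfRep
  obtain ⟨L₀, hLd, hLi⟩ := exists_lorentzHalfLineRep
  have e₁ : Equivalent W β := stub_quarticRational_equivalent_beta W β hWd (fun x _ => by rw [hWi]) hβd hβi
  have e₂ : Equivalent W H := stub_quarticRational_equivalent_half W H hWd (fun x _ => by rw [hWi]) hHd (fun x _ => by rw [hHi])
  have e₃ : Equivalent H (L₀.constMul (Real.sqrt 2) h2) := by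
    refine stub_quarticHalf_equivalent_lorentz H _ hHd (fun x _ => by rw [hHi]) (by rw [IntegralRep.domain_constMul, hLd])
      fun x _ => ?_
    simp only [IntegralRep.integrand_constMul, hLi]
    ring
  have e₄ : Equivalent L₀ piRep :=
    stub_lorentzHalfLine_equivalent_disc L₀ piRep hLd (fun x _ => by rw [hLi]) rfl (fun _ _ => rfl)
  exact e₁.symm.trans (e₂.trans (e₃.trans (e₄.constMul (Real.sqrt 2) h2)))

/-- `sin(π·(1/4)) = √2/2`, the argument written `π · (1/4 : ℚ)`. [folklore] -/
theorem sin_pi_mul_one_quarter : Real.sin (Real.pi * ((1 / 4 : ℚ) : ℝ)) = Real.sqrt 2 / 2 := by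
  rw [show Real.pi * ((1 / 4 : ℚ) : ℝ) = Real.pi / 4 by push_cast; ring, Real.sin_pi_div_four]

/-- **The instance `a = 1/4` of `EulerReflectionRational`** (crux stmt-KontsevichZagierPeriods-3383 of route CompiledSubstitutions,
VERBATIM shape; registered anchor `eulerReflectionRational_one_quarter` of crux stmt-3897): `[(0,1), sin(π/4)·x^{-3/4}(1-x)^{-1/4}] ∼
[closed unit disc, 1]` — Euler's reflection `sin(π/4)Γ(1/4)Γ(3/4) = π` realised by Kontsevich–Zagier moves (quartic Fermat
parametrisation, fold, the substitution `u = √2w(1−w)/(1−2w)`, Cayley map, `PiNormalisation`). [cite: KontsevichZagier2001, §1.2]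
[cite: AndrewsAskeyRoy1999, Thm 1.2.1] -/
theorem eulerReflectionRational_one_quarter : ∀ (r : KZ.IntegralRep 1) (p : KZ.IntegralRep 2),
    r.domain = {x | x 0 ∈ Set.Ioo (0:ℝ) 1} →
    Set.EqOn r.integrand (fun x => Real.sin (Real.pi * ((1/4 : ℚ) : ℝ)) * (x 0) ^ (((1/4 : ℚ) : ℝ) - 1) *
      (1 - x 0) ^ (-((1/4 : ℚ) : ℝ))) r.domain →
    p.domain = {z | z 0 ^ 2 + z 1 ^ 2 ≤ 1} → Set.EqOn p.integrand (fun _ => 1) p.domain → KZ.Equivalent r p := by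
  intro r p hrd hri hpd hpi
  have h2 : IsAlgebraic ℚ (Real.sqrt 2) := by
    refine ⟨Polynomial.X ^ 2 - Polynomial.C 2, Polynomial.X_pow_sub_C_ne_zero (by norm_num) 2, ?_⟩
    simp [Real.sq_sqrt (show (0:ℝ) ≤ 2 by norm_num)]
  have hs2 : Real.sqrt 2 ^ 2 = 2 := Real.sq_sqrt (by norm_num)
  have hc : IsAlgebraic ℚ (Real.sqrt 2 / 2) := by
    simpa [div_eq_mul_inv] using h2.mul (isAlgebraic_rat ℚ 2 : IsAlgebraic ℚ (((2:ℚ)) : ℝ)).inv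
  obtain ⟨β, hβd, hβi⟩ := exists_betaRep' (1 / 4) (3 / 4) (by norm_num) (by norm_num)
  have hβi' : EqOn β.integrand (fun x => (x 0) ^ (-(3:ℝ) / 4) * (1 - x 0) ^ (-(1:ℝ) / 4)) β.domain := by
    intro x _
    rw [hβi]
    norm_num
  have e := (betaQuarter_equivalent_piRep_sqrt2 h2 β hβd hβi').constMul (Real.sqrt 2 / 2) hc
  have hr : Equivalent r (β.constMul (Real.sqrt 2 / 2) hc) := by
    refine of_sub_of_mem_relations_of_eqOn (by rw [IntegralRep.domain_constMul, hβd, hrd]) fun x hx => ?_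
    have hx' : x ∈ β.domain := by rw [hβd, ← hrd]; exact hx
    simp only [IntegralRep.integrand_constMul]
    rw [hri hx, hβi' hx', sin_pi_mul_one_quarter]
    norm_num
    ring
  have hp : Equivalent ((piRep.constMul (Real.sqrt 2) h2).constMul (Real.sqrt 2 / 2) hc) p := by
    refine of_sub_of_mem_relations_of_eqOn (by rw [IntegralRep.domain_constMul, IntegralRep.domain_constMul, hpd]; rfl)
      fun z hz => ?_
    have hz' : z ∈ p.domain := by rw [hpd]; simpa using hz
    simp only [IntegralRep.integrand_constMul, piRep_integrand, hpi hz', mul_one]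
    field_simp
    linarith [hs2]
  exact hr.trans (e.trans hp)

/-- **The instance `a = 3/4` of `EulerReflectionRational`** (verbatim shape): one more reflection `x ↦ 1 − x`
(`KZ.betaReflection_equivalent`) on top of `eulerReflectionRational_one_quarter`; `sin(3π/4) = sin(π/4)`.
[cite: KontsevichZagier2001, §1.2] [cite: AndrewsAskeyRoy1999, Thm 1.2.1] -/
theorem eulerReflectionRational_three_quarters : ∀ (r : KZ.IntegralRep 1) (p : KZ.IntegralRep 2),
    r.domain = {x | x 0 ∈ Set.Ioo (0:ℝ) 1} →
    Set.EqOn r.integrand (fun x => Real.sin (Real.pi * ((3/4 : ℚ) : ℝ)) * (x 0) ^ (((3/4 : ℚ) : ℝ) - 1) *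
      (1 - x 0) ^ (-((3/4 : ℚ) : ℝ))) r.domain →
    p.domain = {z | z 0 ^ 2 + z 1 ^ 2 ≤ 1} → Set.EqOn p.integrand (fun _ => 1) p.domain → KZ.Equivalent r p := by
  intro r p hrd hri hpd hpi
  have hsin : Real.sin (Real.pi * ((3/4 : ℚ) : ℝ)) = Real.sqrt 2 / 2 := by
    rw [show Real.pi * ((3 / 4 : ℚ) : ℝ) = Real.pi - Real.pi / 4 by push_cast; ring, Real.sin_pi_sub, Real.sin_pi_div_four]
  have hc : IsAlgebraic ℚ (Real.sqrt 2 / 2) := by rw [← hsin]; exact isAlgebraic_sin_pi_mul_rat (by norm_num)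
  -- unit cells `β₁ = [x^{-1/4}(1-x)^{-3/4}]`, `β = [x^{-3/4}(1-x)^{-1/4}]`, one reflection between them
  obtain ⟨β₁, hβ₁d, hβ₁i⟩ := exists_betaRep' (3 / 4) (1 / 4) (by norm_num) (by norm_num)
  obtain ⟨β, hβd, hβi⟩ := exists_betaRep' (1 / 4) (3 / 4) (by norm_num) (by norm_num)
  have e₀ : Equivalent β₁ β := by
    refine betaReflection_equivalent (-(1:ℝ) / 4) (-(3:ℝ) / 4) β₁ β hβ₁d (fun x _ => ?_) hβd (fun x _ => ?_)
    · rw [hβ₁i]; norm_num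
    · rw [hβi]; norm_num
  have e₁ : Equivalent r (β₁.constMul (Real.sqrt 2 / 2) hc) := by
    refine of_sub_of_mem_relations_of_eqOn (by rw [IntegralRep.domain_constMul, hβ₁d, hrd]) fun x hx => ?_
    simp only [IntegralRep.integrand_constMul, hβ₁i]
    rw [hri hx, hsin]
    norm_num
    ring
  have e₂ : Equivalent (β.constMul (Real.sqrt 2 / 2) hc) p := by
    refine eulerReflectionRational_one_quarter _ p (by rw [IntegralRep.domain_constMul, hβd]) (fun x _ => ?_) hpd hpi
    simp only [IntegralRep.integrand_constMul, hβi, sin_pi_mul_one_quarter]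
    norm_num
    ring
  exact e₁.trans ((e₀.constMul (Real.sqrt 2 / 2) hc).trans e₂)

/-- The `π`-class at level `4`, in the rung's language: a cell pinned as `[c·β(1/4,3/4)]` is a chain of moves away from
`(c√2)·T`, `T = [β(1/2,1/2)]` (through the disc: `B(1/4,3/4) = √2·π`, `B(1/2,1/2) = π` — `stubEulerReflection_half`).
[cite: KontsevichZagier2001, §1.2] -/
theorem pinned_quarter_threeQuarter_equivalent {c : ℝ} (hc : IsAlgebraic ℚ c) (h2 : IsAlgebraic ℚ (Real.sqrt 2))
    {r T : IntegralRep 1} (hr : Pinned⟦c, (1/4 : ℚ), (3/4 : ℚ), r⟧) (hT : Pinned⟦(1:ℝ), (1/2 : ℚ), (1/2 : ℚ), T⟧)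
    (hk : IsAlgebraic ℚ (c * Real.sqrt 2)) : Equivalent r (T.constMul (c * Real.sqrt 2) hk) := by
  obtain ⟨β, hβ⟩ := exists_pinned 1 isAlgebraic_one (by norm_num : (0:ℚ) < 1/4) (by norm_num : (0:ℚ) < 3/4)
  have e₁ : Equivalent r (β.constMul c hc) := equivalent_constMul_of_pinned hc hr hβ (mul_one c).symm
  have e₂ : Equivalent β (piRep.constMul (Real.sqrt 2) h2) := by
    refine betaQuarter_equivalent_piRep_sqrt2 h2 β hβ.1 fun x hx => ?_
    rw [hβ.2 hx]
    norm_num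
  have e₃ : Equivalent T piRep := by
    refine stubEulerReflection_half T piRep hT.1 (fun x hx => ?_) rfl (fun _ _ => rfl)
    rw [hT.2 hx, show Real.pi * ((1/2 : ℚ) : ℝ) = Real.pi / 2 by push_cast; ring, Real.sin_pi_div_two]
    norm_num
  have e₄ : Equivalent ((piRep.constMul (Real.sqrt 2) h2).constMul c hc) (T.constMul (c * Real.sqrt 2) hk) := by
    refine Equivalent.trans ?_ (e₃.constMul (c * Real.sqrt 2) hk).symm
    refine of_sub_of_mem_relations_of_eqOn rfl fun z _ => ?_
    simp only [IntegralRep.integrand_constMul]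
    ring
  exact e₁.trans ((e₂.constMul c hc).trans e₄)

/-! ## Legendre's duplication in linear form -/

/-- **Legendre's duplication `B(a,a) = 2^{1−2a}·B(a,1/2)` inside the rules** (every rational `a > 0`): a cell pinned as `[β(a,a)]` is
KZ-equivalent to the cell pinned as `[2^{1−2a}·β(a,1/2)]` — fold at `1/2` (`stub_betaSymm_fold`, through the restriction of `[2β(a,a)]` to
`(0,1/2)`) and ONE polynomial substitution `u = 4x(1−x)` (`stub_betaFold_duplication`). [cite: AndrewsAskeyRoy1999, Thm 1.5.1]
[cite: KontsevichZagier2001, §1.2] -/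
theorem pinned_duplication {a : ℚ} (ha : 0 < a) {k : ℝ} (hk2 : k = (2:ℝ) ^ (1 - 2 * (a:ℝ))) {r d : IntegralRep 1}
    (hr : Pinned⟦(1:ℝ), a, a, r⟧) (hd : Pinned⟦k, a, (1/2 : ℚ), d⟧) : Equivalent r d := by
  obtain ⟨R₂, hR₂⟩ := exists_pinned (2:ℝ) (by simpa using (isAlgebraic_rat ℚ 2 : IsAlgebraic ℚ (((2:ℚ)) : ℝ))) ha ha
  have hsub : {x : Fin 1 → ℝ | 0 < x 0 ∧ x 0 < 1 / 2} ⊆ R₂.domain := by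
    rw [hR₂.1]
    intro x hx
    exact ⟨hx.1, by linarith [hx.2]⟩
  set h : IntegralRep 1 := R₂.restrict {x : Fin 1 → ℝ | 0 < x 0 ∧ x 0 < 1 / 2}
    ((KZ.isSemialgebraic_setOf_const_lt_apply isAlgebraic_zero 0).inter
      (KZ.isSemialgebraic_setOf_apply_lt_const isAlgebraic_one_half 0)) hsub with hh
  have hhi : EqOn h.integrand (fun x => 2 * ((x 0) ^ ((a:ℝ) - 1) * (1 - x 0) ^ ((a:ℝ) - 1))) h.domain := by
    intro x hx
    rw [hh, IntegralRep.integrand_restrict, hR₂.2 (hsub hx)]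
    ring
  have e₁ : Equivalent r h :=
    stub_betaSymm_fold a ha r h hr.1 (fun x hx => by simp only [hr.2 hx, one_mul]) rfl hhi
  have e₂ : Equivalent h d := by
    refine stub_betaFold_duplication a ha h d rfl hhi hd.1 fun x hx => ?_
    rw [hd.2 hx, hk2]
    norm_num
    ring
  exact e₁.trans e₂

end Summit.KontsevichZagierPeriods.FermatIsogeny.BetaLinearSector.Quarters

end
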